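import Summits.PneNP.PneNP.Theorems.ExpanderLinearGeneratorsResolutionNFreeLight
import HarnessLib

/-!
# The n-free resolution-size rung for expanding linear systems, XIV: the resolution rung of `LinearGeneratorDepthFregeHard` at every scale for light-expanding systems

Support file for crux `stmt-PneNP-11443`
(`Summit.PneNP.PneNP.Theses.ExpanderLinearGenerators.LinearGeneratorDepthFregeHard`, Krajíček's
Problem 19.4.5 in universal-expander form; also `stmt-PneNP-11442`). Crux-shaped corollaries of
the light-expansion law of file XIII (`resolution_size_nfree_light`):

* `resolution_size_light_pow` — for `ℓ ≥ 1` and `0 ≤ a < ℓ/2 - 1` there are `ε > 0`, `R` with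
  `|π| ≥ 2^{r^ε}` for every `r ≥ R`, every `n, m`, and every `ℓ`-sparse system whose variables of
  column weight `≤ r^a` carry the `(r, 3ℓ/4)`-boundary expansion (n-free, m-free, heavy variables
  arbitrary);
* `resolution_size_light_rpow` — the same at the scale `r = n^{1-δ}` of the crux: the RESOLUTION
  RUNG of `LinearGeneratorDepthFregeHard` for EVERY `δ < 1` on all systems whose variables of
  column weight `≤ n^{a(1-δ)}` carry the expansion. The Ben-Sasson–Wigderson rung
  (`linearGenerator_resolution_size_lower_bound`) needs `δ < 1/2`, and the tree's
  `ResSim.resolution_size_of_light_expansion` is the case "light = column weight `≤ 2`";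
* `resolution_size_rpow_of_colWeight` — in particular, under the crux's OWN expansion hypothesis,
  the resolution rung for every `δ < 1` at column weight `≤ n^{a(1-δ)}`, `a < ℓ/2 - 1`; what is
  left open one rung below the crux is the case where the expansion at scale `n^{1-δ}`, `δ ≥ 1/2`,
  needs variables of column weight `n^{Ω(ℓ(1-δ))}` (the `m ≫ n²` regime of generator tautologies,
  where the restriction technique meets its barrier: Alekhnovich–Ben-Sasson–Razborov–Wigderson
  2004, open problems; Sokolov, CCC 2022).

References: E. Ben-Sasson, A. Wigderson, J. ACM 48 (2001), Thm. 6.5, Cor. 3.6; J. Krajíček,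
*Proof complexity* (CUP 2019), Cor. 13.4.6, Problem 19.4.5; D. Sokolov, *Pseudorandom generators,
resolution and heavy width*, CCC 2022, §1.1.
-/

namespace Summit.PneNP.PneNP.Theorems.ResNFree

set_option linter.dupNamespace false -- `Summit.PneNP.PneNP.…`: summit = sub-problem (D-0017)

open Finset Filter Topology Literature.Computability.Complexity Literature.Computability.MetaComplexity

/-- **The n-free exponential resolution law at polynomial LIGHT column weight (crux-shaped
form).** For every locality `ℓ ≥ 1` and every exponent `0 ≤ a < ℓ/2 - 1` there are `ε > 0` and `R`
such that for all `r ≥ R`, all `n, m` and every `ℓ`-sparse `E : Fin m → LinEqMod 2 n` whose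
variables of column weight `≤ r^a` carry the `(r, 3ℓ/4)`-boundary expansion of the row supports,
every resolution refutation of `sumEncoding 1 E` has at least `2^{r^ε}` lines — uniformly in `n`,
`m` and the heavy variables. [Ben-Sasson–Wigderson 2001, Thm. 6.5; Beame–Pitassi 1996;
Krajíček 2019, §13.4, Problem 19.4.5] [folklore] -/
theorem resolution_size_light_pow (ℓ : ℕ) (hℓ : 1 ≤ ℓ) (a : ℝ) (ha : 0 ≤ a)
    (hal : a < (ℓ : ℝ) / 2 - 1) :
    ∃ ε : ℝ, 0 < ε ∧ ∃ R : ℝ, ∀ r : ℝ, R ≤ r → ∀ (n m : ℕ) (E : Fin m → LinEqMod 2 n),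
      (∀ i, (E i).supp.card ≤ ℓ) →
      IsBoundaryExpander
        (fun i => ((E i).supp.filter fun j =>
          ((((univ : Finset (Fin m)).filter fun i' => j ∈ (E i').supp).card : ℕ) : ℝ) ≤ r ^ a).map
          Fin.valEmbedding) r (3 / 4 * ℓ) →
      ∀ π : List (ResLine ℕ), IsResRefutation (sumEncoding 1 E) π →
        (2 : ℝ) ^ (r ^ ε) ≤ (π.length : ℝ) := by
  classical
  -- the exponent gap (as in `resolution_size_column_pow`)
  set ε₀ : ℝ := ((ℓ : ℝ) / 2 - 1 - a) / ℓ with hε₀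
  have hℓ' : (1 : ℝ) ≤ ℓ := by exact_mod_cast hℓ
  have hℓ0 : (0 : ℝ) < ℓ := by linarith
  have hgap : 0 < (ℓ : ℝ) / 2 - 1 - a := by linarith
  have hε₀pos : 0 < ε₀ := by rw [hε₀]; positivity
  have hε₀lt : ε₀ < 1 := by
    rw [hε₀, div_lt_one hℓ0]; linarith
  set δ : ℝ := ((ℓ : ℝ) / 2 - 1 - a) / 2 with hδ
  have hδpos : 0 < δ := by rw [hδ]; positivity
  have hexpo : (1 - ε₀) * ℓ / 2 - 1 = a + δ := by
    rw [hε₀, hδ]; field_simp; ring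
  refine ⟨ε₀ / 2, by positivity, ?_⟩
  have hev1 : ∀ᶠ r : ℝ in atTop, (2 : ℝ) ^ ℓ ≤ r ^ δ :=
    (tendsto_rpow_atTop hδpos).eventually (eventually_ge_atTop _)
  have hev2 : ∀ᶠ r : ℝ in atTop, 128 * (ℓ : ℝ) + 1 ≤ r ^ (ε₀ / 2) :=
    (tendsto_rpow_atTop (by positivity)).eventually (eventually_ge_atTop _)
  obtain ⟨R, hR⟩ := Filter.eventually_atTop.1 ((hev1.and hev2).and (eventually_ge_atTop (4 : ℝ)))
  refine ⟨R, fun r hr n m E hsparse hexp π hπ => ?_⟩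
  obtain ⟨⟨hr1, hr2⟩, hr4⟩ := hR r hr
  have hr0 : 0 < r := by linarith
  -- the light set at threshold `⌊r^a⌋`
  set Δ : ℕ := ⌊r ^ a⌋₊ with hΔdef
  have hiff : ∀ j : Fin n,
      ((((univ : Finset (Fin m)).filter fun i' => j ∈ (E i').supp).card : ℕ) : ℝ) ≤ r ^ a ↔
        ((univ : Finset (Fin m)).filter fun i' => j ∈ (E i').supp).card ≤ Δ := fun j => by
    rw [hΔdef]; exact (Nat.le_floor_iff (Real.rpow_nonneg hr0.le a)).symm
  have hexpΔ : IsBoundaryExpander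
      (fun i => ((E i).supp.filter fun j =>
        ((univ : Finset (Fin m)).filter fun i' => j ∈ (E i').supp).card ≤ Δ).map Fin.valEmbedding)
      r (3 / 4 * ℓ) := by
    have : (fun i => ((E i).supp.filter fun j =>
        ((univ : Finset (Fin m)).filter fun i' => j ∈ (E i').supp).card ≤ Δ).map Fin.valEmbedding) =
        fun i => ((E i).supp.filter fun j =>
          ((((univ : Finset (Fin m)).filter fun i' => j ∈ (E i').supp).card : ℕ) : ℝ) ≤ r ^ a).map
          Fin.valEmbedding :=
      funext fun i => by rw [Finset.filter_congr fun j _ => (hiff j).symm]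
    rw [this]
    exact hexp
  have hΔ : (Δ : ℝ) ≤ r ^ ((1 - ε₀) * ℓ / 2 - 1) / 2 ^ ℓ := by
    rw [hexpo, le_div_iff₀ (by positivity), Real.rpow_add hr0]
    have h1 : (Δ : ℝ) ≤ r ^ a := Nat.floor_le (Real.rpow_nonneg hr0.le a)
    exact mul_le_mul h1 hr1 (by positivity) (Real.rpow_nonneg hr0.le a)
  have hmain := resolution_size_nfree_light ℓ hℓ ε₀ hε₀pos hε₀lt r hr4 n m Δ E hsparse hexpΔ hΔ π hπ
  -- `r^{ε₀/2} ≤ r^{ε₀}/(128 ℓ) - 1`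
  have hz : r ^ (ε₀ / 2) ≤ r ^ ε₀ / (128 * ℓ) - 1 := by
    set z : ℝ := r ^ (ε₀ / 2) with hz
    have hzz : r ^ ε₀ = z * z := by
      rw [hz, ← Real.rpow_add hr0]; congr 1; ring
    rw [hzz, le_sub_iff_add_le, le_div_iff₀ (by positivity)]
    have hz1 : 128 * (ℓ : ℝ) + 1 ≤ z := hr2
    have hz0 : 0 ≤ z := by rw [hz]; exact Real.rpow_nonneg hr0.le _
    nlinarith only [hz1, hz0, hℓ']
  calc (2 : ℝ) ^ (r ^ (ε₀ / 2)) ≤ (2 : ℝ) ^ (r ^ ε₀ / (128 * ℓ) - 1) :=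
        Real.rpow_le_rpow_of_exponent_le (by norm_num) hz
    _ ≤ (π.length : ℝ) := hmain

/-- **The resolution rung of `LinearGeneratorDepthFregeHard` at EVERY expansion scale, for
light-expanding systems.** For every locality `ℓ ≥ 1`, every `δ < 1` and every exponent
`0 ≤ a < ℓ/2 - 1` there are `ε > 0` and `N` such that for all `n ≥ N`, all `m` and every
`ℓ`-sparse `E : Fin m → LinEqMod 2 n` whose variables of column weight `≤ n^{a(1-δ)}` carry the
`(n^{1-δ}, 3ℓ/4)`-boundary expansion of the row supports, every resolution refutation of
`sumEncoding 1 E` has at least `2^{n^ε}` lines. The Ben-Sasson–Wigderson rung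
(`linearGenerator_resolution_size_lower_bound`, Krajíček Cor. 13.4.6) needs `δ < 1/2`; the tree's
`ResSim.resolution_size_of_light_expansion` is the case "light = column weight `≤ 2`". What remains
open at the resolution rung of crux 11443 is the case where the expansion at scale `n^{1-δ}`,
`δ ≥ 1/2`, needs variables of column weight `> n^{a(1-δ)}` for every `a < ℓ/2 - 1`.
[Ben-Sasson–Wigderson 2001, Thm. 6.5; Krajíček 2019, Cor. 13.4.6, Problem 19.4.5] [folklore] -/
theorem resolution_size_light_rpow (ℓ : ℕ) (hℓ : 1 ≤ ℓ) (δ : ℝ) (hδ1 : δ < 1)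
    (a : ℝ) (ha : 0 ≤ a) (hal : a < (ℓ : ℝ) / 2 - 1) :
    ∃ ε : ℝ, 0 < ε ∧ ∃ N : ℕ, ∀ n : ℕ, N ≤ n → ∀ (m : ℕ) (E : Fin m → LinEqMod 2 n),
      (∀ i, (E i).supp.card ≤ ℓ) →
      IsBoundaryExpander
        (fun i => ((E i).supp.filter fun j =>
          ((((univ : Finset (Fin m)).filter fun i' => j ∈ (E i').supp).card : ℕ) : ℝ) ≤
            (n : ℝ) ^ (a * (1 - δ))).map Fin.valEmbedding)
        ((n : ℝ) ^ (1 - δ)) (3 / 4 * ℓ) →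
      ∀ π : List (ResLine ℕ), IsResRefutation (sumEncoding 1 E) π →
        (2 : ℝ) ^ ((n : ℝ) ^ ε) ≤ (π.length : ℝ) := by
  obtain ⟨ε, hε, R, hR⟩ := resolution_size_light_pow ℓ hℓ a ha hal
  have h1δ : 0 < 1 - δ := by linarith
  refine ⟨ε * (1 - δ), mul_pos hε h1δ, ?_⟩
  have hev : ∀ᶠ n : ℕ in atTop, R ≤ ((n : ℝ)) ^ (1 - δ) :=
    ((tendsto_rpow_atTop h1δ).comp tendsto_natCast_atTop_atTop).eventually (eventually_ge_atTop R)
  obtain ⟨N, hN⟩ := Filter.eventually_atTop.1 hev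
  refine ⟨N, fun n hn m E hsparse hexp π hπ => ?_⟩
  have hn0 : (0 : ℝ) ≤ n := Nat.cast_nonneg n
  have hra : ((n : ℝ) ^ (1 - δ)) ^ a = (n : ℝ) ^ (a * (1 - δ)) := by
    rw [← Real.rpow_mul hn0]; congr 1; ring
  have hrε : ((n : ℝ) ^ (1 - δ)) ^ ε = (n : ℝ) ^ (ε * (1 - δ)) := by
    rw [← Real.rpow_mul hn0]; congr 1; ring
  have h := hR ((n : ℝ) ^ (1 - δ)) (hN n hn) n m E hsparse (by rw [hra]; exact hexp) π hπ
  rwa [hrε] at h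

/-- **The resolution rung of `LinearGeneratorDepthFregeHard` at EVERY scale for systems of
polynomially bounded column weight.** For every `ℓ ≥ 1`, `δ < 1` and `0 ≤ a < ℓ/2 - 1` there are
`ε > 0` and `N` such that for `n ≥ N`: every `ℓ`-sparse `E : Fin m → LinEqMod 2 n` whose supports
form an `(n^{1-δ}, 3ℓ/4)`-boundary expander (the crux's own hypothesis) and each of whose variables
lies in at most `n^{a(1-δ)}` rows admits no resolution refutation of `sumEncoding 1 E` with fewer
than `2^{n^ε}` lines. (All variables are light, so `resolution_size_light_rpow` applies with the
full supports.) For `δ ≥ 1/2` — where the size–width rung is void — this is the first resolution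
size lower bound in the tree beyond column weight `2` at the crux's scale.
[Ben-Sasson–Wigderson 2001, Thm. 6.5; Krajíček 2019, Cor. 13.4.6, Problem 19.4.5] [folklore] -/
theorem resolution_size_rpow_of_colWeight (ℓ : ℕ) (hℓ : 1 ≤ ℓ) (δ : ℝ) (hδ1 : δ < 1)
    (a : ℝ) (ha : 0 ≤ a) (hal : a < (ℓ : ℝ) / 2 - 1) :
    ∃ ε : ℝ, 0 < ε ∧ ∃ N : ℕ, ∀ n : ℕ, N ≤ n → ∀ (m : ℕ) (E : Fin m → LinEqMod 2 n),
      (∀ i, (E i).supp.card ≤ ℓ) →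
      IsBoundaryExpander (fun i => (E i).supp.map Fin.valEmbedding) ((n : ℝ) ^ (1 - δ)) (3 / 4 * ℓ) →
      (∀ j : Fin n, ((((univ : Finset (Fin m)).filter fun i' => j ∈ (E i').supp).card : ℕ) : ℝ) ≤
        (n : ℝ) ^ (a * (1 - δ))) →
      ∀ π : List (ResLine ℕ), IsResRefutation (sumEncoding 1 E) π →
        (2 : ℝ) ^ ((n : ℝ) ^ ε) ≤ (π.length : ℝ) := by
  obtain ⟨ε, hε, N, hN⟩ := resolution_size_light_rpow ℓ hℓ δ hδ1 a ha hal
  refine ⟨ε, hε, N, fun n hn m E hsparse hexp hcol π hπ => hN n hn m E hsparse ?_ π hπ⟩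
  have : (fun i => ((E i).supp.filter fun j =>
      ((((univ : Finset (Fin m)).filter fun i' => j ∈ (E i').supp).card : ℕ) : ℝ) ≤
        (n : ℝ) ^ (a * (1 - δ))).map Fin.valEmbedding) = fun i => (E i).supp.map Fin.valEmbedding :=
    funext fun i => by rw [Finset.filter_true_of_mem fun j _ => hcol j]
  rw [this]
  exact hexp

end Summit.PneNP.PneNP.Theorems.ResNFree
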